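import Mathlib
import HarnessLib.Audit
import Summits.PneNP.PneNP.Theorems.PstarNorUnitCases

/-!
# A NOR-forced chord is a CONS-T unit with SINGLE literals (ROUND-24, memo §9 R7/R8; O5 "composite literals" is impossible)

FRONTIER range-avoidance ladder, rung F-N3, ROUND 24 (cell `pnp-ideate`, planner memo `r24/CORE-BOUND-NOTES.md` §9 R7 (NOR case) / R8, §10 O5,
§13; restricted-model proof complexity — nothing here bears on `P` versus `NP`).

**Theorem `nor_unit`.**  Pure `P⋆` instance with simple overlaps, `(r, 3/2)`-boundary expanding.  Data of ONE forced chord in the NOR case of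
`PstarChordForcing.forced_chord_cases`, read on the instance:
* `P` — the chord's fundamental path family, `e ∉ P` the chord, closing `P` into an XOR cycle (no XOR variable of `P ∪ {e}` on the boundary of
  `P ∪ {e}` — true for the terminal core's fundamental cycles, which are XOR-closed);
* the NOR identity `Q_P + c = μ₁ m₁ + μ₂ m₂` (`μ_i = λ_i + 1`, `m_i` affine) and the rank hypothesis `codim rad B_P ≥ 4` (`PstarPathRank`);
* `G` — outputs disjoint from `P ∪ {e}` REALISING THE LITERAL PRODUCTS: whenever `ℓ₁(e_v)ℓ₂(e_w) + ℓ₁(e_w)ℓ₂(e_v) = 1` (i.e. `{v,w}` is a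
  quadratic monomial of `λ₁λ₂`, equivalently of the second constraint `q = λ₁λ₂ + 1`), some `g ∈ G` has AND pair `{v, w}` (in the bridge:
  `w₂`'s folded pendants / x-read tree monomials); `#(P ∪ {e} ∪ G) ≤ r`.
CONCLUSION: `P = {j₁, j₂}` with disjoint AND pairs, literals `σ ∈ andPair j₁`, `τ ∈ andPair j₂` such that the literal variables (those with
`ℓ₁(e_v) ≠ 0 ∨ ℓ₂(e_v) ≠ 0`) are EXACTLY `{σ, τ}`, and a gadget `g ∈ G` with AND pair `{σ, τ}`.  So the literal span is spanned by two
COORDINATES (single literals — memo O5's composite classes never occur), the forced path is the CONS-T pair `(σ,b)(τ,b′)`, and the NOR gadget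
`(σ,τ)` exists: the local shape of `PstarLitNorCore.LitNorStructure`.

Proof: `PstarNorUnitPolar` (rank `B_P = 4`: no induced 3-matching, no literal off the path, `adj_eq`) + `PstarNorUnitGraph` (`2K₂` or
cherry-plus-edge) + `PstarNorUnitTools` / `PstarNorUnitCases` (`𝔽₂²` type facts, all-minors-zero ⟹ rank `≤ 2`, boundary of cycle-plus-gadgets,
the `2K₂` cases): the cherry dies by one gadget (`14 < 15`) or by the rank bound; a two-literal edge dies by two gadgets; what is left is one
literal per edge.  Sanity: exhaustive enumeration of the combinatorial core for `≤ 7` AND variables (kit j307174).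
-/

set_option linter.dupNamespace false -- `Summit.PneNP.PneNP.…`: summit = sub-problem name (D-0017 single-conjunct layout)

open Finset Module Literature.Computability.Complexity
open Summit.PneNP.PneNP.Theorems.PstarSALevel (varSet bdry BoundaryExpanding SimpleOverlap)
open Summit.PneNP.PneNP.Theorems.PstarGapLinearised (andPair andPair_subset_varSet)
open Summit.PneNP.PneNP.Theorems.PstarChordEndgameTools (mem_andPair_iff)
open Summit.PneNP.PneNP.Theorems.PstarCubeIdeals (IsAffineFn)
open Summit.PneNP.PneNP.Theorems.PstarQuadRank (rad)
open Summit.PneNP.PneNP.Theorems.PstarRankRigidityTwo (linPart)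
open Summit.PneNP.PneNP.Theorems.PstarProductRank (qform polar IsInducedMatching)
open Summit.PneNP.PneNP.Theorems.PstarPathRank (AndAdj and_ne)
open Summit.PneNP.PneNP.Theorems.PstarNorUnitPolar (exists_mem_andPair_of_lit adj_eq card_le_two_of_isInducedMatching two_le_card)
open Summit.PneNP.PneNP.Theorems.PstarNorUnitGraph (adeg leafEdges mem_leafEdges adeg_pos card_leaves_le two_edges_or_cherry)
open Summit.PneNP.PneNP.Theorems.PstarNorUnitTools (lit_of_adj rank_lt_of_dets_zero)
open Summit.PneNP.PneNP.Theorems.PstarNorUnitCases (lits_of_det andPair_eq_of_mem false_of_gadgets of_lits false_of_four_lit)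

namespace Summit.PneNP.PneNP.Theorems.PstarNorUnit

variable {n m : ℕ}

/-- In `𝔽₂`, `x + x = 0`. -/
private theorem zmod2_add_self (x : ZMod 2) : x + x = 0 := by
  revert x; decide

section Main

variable {I : LocalMap 4 n m} (hI : I.IsPure xorAndPred) (hS : SimpleOverlap I) {r : ℕ} (hB : BoundaryExpanding r I)
  {P G : Finset (Fin m)} {e : Fin m} (he : e ∉ P) (hGd : Disjoint G (insert e P)) (hr : (insert e P ∪ G).card ≤ r)
  (hcyc : ∀ j ∈ insert e P, ∀ s : Fin 4, s.val < 2 → I.vars j s ∉ bdry I (insert e P))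
  {μ₁ μ₂ m₁ m₂ : (Fin n → ZMod 2) → ZMod 2} (hμ₁ : IsAffineFn μ₁) (hμ₂ : IsAffineFn μ₂) (hm₁ : IsAffineFn m₁) (hm₂ : IsAffineFn m₂)
  {c : ZMod 2} (hQ : ∀ x, qform P (fun j => I.vars j 2) (fun j => I.vars j 3) x + c = μ₁ x * m₁ x + μ₂ x * m₂ x)
  (hK : ∀ v w : Fin n, v ≠ w →
    linPart hμ₁ (Pi.single v 1) * linPart hμ₂ (Pi.single w 1) + linPart hμ₁ (Pi.single w 1) * linPart hμ₂ (Pi.single v 1) = 1 →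
      ∃ g ∈ G, v ∈ andPair I g ∧ w ∈ andPair I g)

include hI hS hB he hGd hr hcyc hμ₁ hμ₂ hm₁ hm₂ hQ hK

omit hI hS in
/-- **The cherry-plus-edge is impossible.**  Either two path variables have profiles with `det = 1` — then one gadget kills (`|P ∪ {e}| = 4`, one
gadget, at most `3` uncovered leaves: `14 < 15`) — or all minors vanish on the path variables, hence everywhere (no literal off the path), and
`rank_lt_of_dets_zero` contradicts rank four. -/
theorem false_of_cherry (hrank : finrank (ZMod 2) (rad (polar P (fun j => I.vars j 2) (fun j => I.vars j 3))) + 4 ≤ finrank (ZMod 2) (Fin n → ZMod 2))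
    {j₀ j₂ j₃ : Fin m} {cc : Fin n} (h02 : j₀ ≠ j₂) (h03 : j₀ ≠ j₃) (h23 : j₂ ≠ j₃) (hP : P = {j₀, j₂, j₃}) (hc0 : cc ∈ andPair I j₀)
    (hc2 : cc ∈ andPair I j₂) (hadeg : adeg I P cc = 2) (hother : ∀ v : Fin n, v ≠ cc → adeg I P v ≤ 1) : False := by
  classical
  have zc : ∀ t : ZMod 2, t = 0 ∨ t = 1 := by decide
  have hP3 : P.card = 3 := by
    rw [hP, card_insert_of_notMem (by simp [h02, h03]), card_pair h23]
  by_cases hdet : ∃ x ∈ P.biUnion (andPair I), ∃ y ∈ P.biUnion (andPair I), x ≠ y ∧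
      linPart hμ₁ (Pi.single x 1) * linPart hμ₂ (Pi.single y 1) + linPart hμ₁ (Pi.single y 1) * linPart hμ₂ (Pi.single x 1) = 1
  · -- one gadget kills
    obtain ⟨x, hx, y, hy, hxy, hd⟩ := hdet
    obtain ⟨g, hg, hxg, hyg⟩ := hK x y hxy hd
    have hAg := andPair_eq_of_mem hxg hyg hxy
    obtain ⟨z, hzg, hzc⟩ : ∃ z ∈ andPair I g, z ≠ cc := by
      by_cases hxc : x = cc
      · exact ⟨y, hyg, fun h => hxy (hxc.trans h.symm)⟩
      · exact ⟨x, hxg, hxc⟩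
    have hzA : z ∈ P.biUnion (andPair I) := by
      rw [hAg, mem_insert, mem_singleton] at hzg
      rcases hzg with rfl | rfl
      · exact hx
      · exact hy
    have hz1 : adeg I P z = 1 := by
      obtain ⟨j, hj, hzj⟩ := mem_biUnion.1 hzA
      exact le_antisymm (hother z hzc) (adeg_pos hj hzj)
    -- at most one leaf edge (`j₃`), hence at most `4` leaves
    have hEL : (leafEdges I P).card ≤ 1 := by
      refine (card_le_card fun j hj => ?_).trans (card_singleton j₃).le
      obtain ⟨hjP, hj2, hj3⟩ := mem_leafEdges.1 hj
      have key : cc ∉ andPair I j := by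
        intro hcj
        rcases (mem_andPair_iff I j cc).1 hcj with h | h
        · rw [← h] at hj2; omega
        · rw [← h] at hj3; omega
      rw [hP] at hjP
      simp only [mem_insert, mem_singleton] at hjP
      rcases hjP with rfl | rfl | rfl
      · exact absurd hc0 key
      · exact absurd hc2 key
      · exact mem_singleton_self _
    have hL : (univ.filter fun v => adeg I P v = 1).card ≤ 4 := by
      have := card_leaves_le (I := I) (P := P); omega
    refine false_of_gadgets hB hGd hr hcyc {g} (fun g' hg' => by rw [mem_singleton] at hg'; rw [hg']; exact hg) ?_ 3 ?_ ?_
    · intro g' hg' v hv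
      rw [mem_singleton] at hg'
      rw [hg', hAg, mem_insert, mem_singleton] at hv
      rcases hv with rfl | rfl
      · exact mem_biUnion.1 hx
      · exact mem_biUnion.1 hy
    · calc ((univ.filter fun v => adeg I P v = 1).filter fun v => ∀ g' ∈ ({g} : Finset (Fin m)), v ∉ andPair I g').card
          ≤ ((univ.filter fun v => adeg I P v = 1).erase z).card := by
            refine card_le_card fun v hv => ?_
            rw [mem_filter] at hv
            rw [mem_erase]
            exact ⟨fun h => hv.2 g (mem_singleton_self _) (h ▸ hzg), hv.1⟩
        _ = (univ.filter fun v => adeg I P v = 1).card - 1 := card_erase_of_mem (mem_filter.2 ⟨mem_univ _, hz1⟩)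
        _ ≤ 3 := by omega
    · rw [card_insert_of_notMem he, hP3, card_singleton]; norm_num
  · -- all minors vanish: rank at most two
    push Not at hdet
    refine rank_lt_of_dets_zero hμ₁ hμ₂ hm₁ hm₂ hQ (fun v w => ?_) hrank
    rcases zc (linPart hμ₁ (Pi.single v 1) * linPart hμ₂ (Pi.single w 1) +
        linPart hμ₁ (Pi.single w 1) * linPart hμ₂ (Pi.single v 1)) with h0 | h1
    · exact h0
    · exfalso
      obtain ⟨hlv, hlw⟩ := lits_of_det h1
      obtain ⟨jv, hjv, hvj⟩ := exists_mem_andPair_of_lit hμ₁ hμ₂ hm₁ hm₂ hQ hrank hlv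
      obtain ⟨jw, hjw, hwj⟩ := exists_mem_andPair_of_lit hμ₁ hμ₂ hm₁ hm₂ hQ hrank hlw
      have hvw : v ≠ w := by
        rintro rfl
        rw [zmod2_add_self] at h1
        exact zero_ne_one h1
      exact hdet v (mem_biUnion.2 ⟨jv, hjv, hvj⟩) w (mem_biUnion.2 ⟨jw, hjw, hwj⟩) hvw h1

/-- **`nor_unit` — a NOR-forced chord is a CONS-T unit with single literals** (see the module docstring). -/
theorem nor_unit (hrank : finrank (ZMod 2) (rad (polar P (fun j => I.vars j 2) (fun j => I.vars j 3))) + 4 ≤ finrank (ZMod 2) (Fin n → ZMod 2)) :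
    ∃ j₁ j₂ : Fin m, ∃ σ τ : Fin n, j₁ ≠ j₂ ∧ P = {j₁, j₂} ∧ Disjoint (andPair I j₁) (andPair I j₂) ∧ σ ∈ andPair I j₁ ∧ τ ∈ andPair I j₂ ∧
      (∀ v : Fin n, (linPart hμ₁ (Pi.single v 1) ≠ 0 ∨ linPart hμ₂ (Pi.single v 1) ≠ 0) ↔ (v = σ ∨ v = τ)) ∧
      ∃ g ∈ G, σ ∈ andPair I g ∧ τ ∈ andPair I g := by
  classical
  have hadj := adj_eq hμ₁ hμ₂ hm₁ hm₂ hQ hI hS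
  have h2 : 2 ≤ P.card := two_le_card hrank
  have hIM : ∀ M : Finset (Fin m), IsInducedMatching P M (fun j => I.vars j 2) (fun j => I.vars j 3) → M.card ≤ 2 :=
    fun M hM => card_le_two_of_isInducedMatching hμ₁ hμ₂ hm₁ hm₂ hQ hM
  have hexp0 : 3 * (insert e P).card ≤ 2 * (bdry I (insert e P)).card := hB _ ((card_le_card subset_union_left).trans hr)
  rcases two_edges_or_cherry hI hS h2 hIM he hcyc hexp0 with ⟨j₁, j₂, hne, hP, hdisj⟩ |
      ⟨j₀, j₂, j₃, cc, h02, h03, h23, hP, hc0, hc2, -, hadeg, hother⟩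
  · -- `2K₂`: each edge has a literal end; dispatch on the other ends
    have hj₁ : j₁ ∈ P := by rw [hP]; exact mem_insert_self _ _
    have hj₂ : j₂ ∈ P := by rw [hP]; exact mem_insert_of_mem (mem_singleton_self _)
    have hne₁ := and_ne I hI j₁
    have hne₂ := and_ne I hI j₂
    have e1 := hadj (I.vars j₁ 2) (I.vars j₁ 3)
    rw [if_pos ⟨j₁, hj₁, Or.inl ⟨rfl, rfl⟩⟩] at e1
    have e2 := hadj (I.vars j₂ 2) (I.vars j₂ 3)
    rw [if_pos ⟨j₂, hj₂, Or.inl ⟨rfl, rfl⟩⟩] at e2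
    have main : ∀ {σ σ' τ τ' : Fin n}, andPair I j₁ = {σ, σ'} → andPair I j₂ = {τ, τ'} → σ ≠ σ' → τ ≠ τ' →
        (linPart hμ₁ (Pi.single σ 1) ≠ 0 ∨ linPart hμ₂ (Pi.single σ 1) ≠ 0) →
        (linPart hμ₁ (Pi.single τ 1) ≠ 0 ∨ linPart hμ₂ (Pi.single τ 1) ≠ 0) →
        ∃ j₁ j₂ : Fin m, ∃ σ τ : Fin n, j₁ ≠ j₂ ∧ P = {j₁, j₂} ∧ Disjoint (andPair I j₁) (andPair I j₂) ∧ σ ∈ andPair I j₁ ∧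
          τ ∈ andPair I j₂ ∧ (∀ v : Fin n, (linPart hμ₁ (Pi.single v 1) ≠ 0 ∨ linPart hμ₂ (Pi.single v 1) ≠ 0) ↔ (v = σ ∨ v = τ)) ∧
          ∃ g ∈ G, σ ∈ andPair I g ∧ τ ∈ andPair I g := by
      intro σ σ' τ τ' hσe hτe hσσ' hττ' hlσ hlτ
      by_cases hlτ' : linPart hμ₁ (Pi.single τ' 1) ≠ 0 ∨ linPart hμ₂ (Pi.single τ' 1) ≠ 0
      · by_cases hlσ' : linPart hμ₁ (Pi.single σ' 1) ≠ 0 ∨ linPart hμ₂ (Pi.single σ' 1) ≠ 0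
        · exact (false_of_four_lit hI hS hB he hGd hr hcyc hμ₁ hμ₂ hm₁ hm₂ hQ hK hP hne hdisj hσe hτe hσσ' hττ' hlσ hlσ' hlτ hlτ').elim
        · -- the two-literal edge is `j₂`: swap the roles of the edges
          have hP' : P = {j₂, j₁} := by rw [hP, pair_comm]
          obtain ⟨a, b, x, y, h⟩ :=
            of_lits hI hS hB he hGd hr hcyc hμ₁ hμ₂ hm₁ hm₂ hQ hK hP' hne.symm hdisj.symm hτe hσe hττ' hσσ' hrank hlτ hlσ hlσ'
          exact ⟨a, b, x, y, h⟩
      · exact of_lits hI hS hB he hGd hr hcyc hμ₁ hμ₂ hm₁ hm₂ hQ hK hP hne hdisj hσe hτe hσσ' hττ' hrank hlσ hlτ hlτ'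
    have hA₁ : andPair I j₁ = {I.vars j₁ 2, I.vars j₁ 3} := rfl
    have hA₁' : andPair I j₁ = {I.vars j₁ 3, I.vars j₁ 2} := pair_comm _ _
    have hA₂ : andPair I j₂ = {I.vars j₂ 2, I.vars j₂ 3} := rfl
    have hA₂' : andPair I j₂ = {I.vars j₂ 3, I.vars j₂ 2} := pair_comm _ _
    rcases lit_of_adj e1 with hl | hl <;> rcases lit_of_adj e2 with hl' | hl'
    · exact main hA₁ hA₂ hne₁ hne₂ hl hl'
    · exact main hA₁ hA₂' hne₁ hne₂.symm hl hl'
    · exact main hA₁' hA₂ hne₁.symm hne₂ hl hl'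
    · exact main hA₁' hA₂' hne₁.symm hne₂.symm hl hl'
  · exact (false_of_cherry hB he hGd hr hcyc hμ₁ hμ₂ hm₁ hm₂ hQ hK hrank h02 h03 h23 hP hc0 hc2 hadeg hother).elim

end Main

end Summit.PneNP.PneNP.Theorems.PstarNorUnit
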